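import Mathlib
import HarnessLib
import Summits.HubbardSuperconductivity.HubbardSuperconductivity.Theorems.KLProgrammeKLRegimeEngineLadderIncrement

/-!
# Route `KLProgramme` — crux K3, ENGINE child gen 4 (stmt-HubbardSuperconductivity-19855), clause (E2-v8) at `1 ≤ n`:
# the CONTINUOUS-SCALE form of the core — a Duhamel / Gronwall comparison for the pair-vertex flow within ONE slice,
# `Γ̇ = −Γ·diag ḃ·Γ + X` ⇒ `|Γ(1) − F_{b(1)−b(0)}(Γ(0))| ≤ 4·sup|X|`, and the constructor `pairLadderStepAtV8_of_flow`

Cell gate-hubbard-kl, seat hubbard-kl-k3c1-p1 (g4), technique «composed-map remainder propagation» — here composed CONTINUOUSLY.  The tree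
carries the effective action at every real scale (`hubbardEffectiveActionCT … Λ`) and Salmhofer's RGE for it (`GrassmannPolchinskiEquation`,
`hasCoeffDerivAt_effAction_flow`), so the expansion owner may organise the (E2) step as a FLOW inside the slice `[Λ_n, Λ_{n−1}]` (parameter
`t ∈ [0,1]`): the pair vertex `Γ(t)` on `TorusSite 2 L × F`, the cumulative pair rungs `b(t)` (so the step weight is `z′ = b(1) − b(0)` — the FULL
increment, automatically) and the non-ladder forcing `X(t) := Γ̇(t) + Γ(t)·diag ḃ(t)·Γ(t)` (crossed channels, six-leg tadpoles, two-leg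
insertions — where the gains live; STEP-LOCAL: only scales inside the slice enter).  This file turns a sup bound on `X` into the (E2) clause:

* `kllf_gronwall_const` — `gronwallBound 0 K ε 1 ≤ 2ε` for `0 ≤ K ≤ 1`, `0 ≤ ε` (via `Real.abs_exp_sub_one_le`).
* **`kllf_duhamel`** (generic finite carrier): if `t ↦ Γ(t)`, `t ↦ b(t)` are differentiable on `[0,1]` (entrywise), `|Γ(t)| ≤ m`, the rung RATE
  `Σ_a ‖ḃ(t,a)‖ ≤ β` and accumulated mass `Σ_a ‖b(t,a) − b(0,a)‖ ≤ Z` with `m·β ≤ 1/3`, `m·Z ≤ 1/3`, and `|X(t)| ≤ ξ` entrywise, then for any right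
  inverse `N` of `1 + diag(b(1)−b(0))·Γ(0)`: `|Γ(1) − Γ(0)·N| ≤ 4·ξ` entrywise.  Proof: the Bethe–Salpeter DEFECT `R(t) := Γ(t)·(1 + diag(b(t)−b(0))·Γ(0))
  − Γ(0)` solves the LINEAR equation `Ṙ = X·(1 + diag(b−b(0))·Γ(0)) − Γ·diag ḃ·R`, `R(0) = 0` (no inverse is differentiated), Gronwall in the
  entrywise sup norm gives `‖R(1)‖ ≤ 2·(4/3)ξ`, and `Γ(1) − Γ(0)N = R(1)·N` with `|R(1)·N| ≤ (3/2)‖R(1)‖` (`klcrs_single_slice`).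
* **`pairLadderStepAtV8_of_flow`** (model, BY NAME on BundleV12): per pair class the engine supplies the flow data `Γ, Γ̇, b, ḃ` on `[0,1]` with the
  bounds above, the identification `𝒞_n(Qm;k,k′) = Γ(1)((k,a₀),(k′,a₀))`, the localisation `‖Γ(0)(a,b) − 𝒞̂_{n−1}(Qm;a.1,b.1)‖ ≤ ε` on
  relevant-or-external pairs, the (m)/(neg)/(real) inputs for `z′ = b(1) − b(0)`, and `4·ξ + (9/4)·ε ≤ drivePBar + eremBar + thermalBar +
  legDressBarQ·countT` ⇒ `PairLadderStepAtV8 … n`.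
Real analysis + linear algebra only; nothing about the model is asserted.  0 kit.
-/

noncomputable section

namespace Summit.HubbardSuperconductivity.HubbardSuperconductivity.Theorems.KLRegimeSplit

set_option linter.dupNamespace false -- summit = problem name (single-conjunct summit), D-0017

open Finset Matrix Set Literature.MathematicalPhysics.QuantumLattice Literature.Probability.LatticeModels
open Summit.HubbardSuperconductivity.HubbardSuperconductivity.Theorems.KLProgrammeCooperResummation
open Summit.HubbardSuperconductivity.HubbardSuperconductivity.Theorems.KLProgrammeLegKernels

/-! ## §1 A numerical Gronwall constant -/

/-- `gronwallBound 0 K ε 1 ≤ 2·ε` for `0 ≤ K ≤ 1`, `0 ≤ ε` (`e^K − 1 ≤ 2K` on `[0,1]`). -/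
theorem kllf_gronwall_const {K ε : ℝ} (hK0 : 0 ≤ K) (hK1 : K ≤ 1) (hε : 0 ≤ ε) : gronwallBound 0 K ε 1 ≤ 2 * ε := by
  by_cases hK : K = 0
  · rw [hK, gronwallBound_K0]; simp only; linarith
  · rw [gronwallBound_of_K_ne_0 hK]
    simp only [zero_mul, mul_one, zero_add]
    have hKpos : 0 < K := lt_of_le_of_ne hK0 (Ne.symm hK)
    have hexp : Real.exp K - 1 ≤ 2 * K := by
      have h := Real.abs_exp_sub_one_le (x := K) (by rw [abs_of_nonneg hK0]; exact hK1)
      rw [abs_of_nonneg hK0] at h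
      exact (le_abs_self _).trans h
    calc ε / K * (Real.exp K - 1) ≤ ε / K * (2 * K) := mul_le_mul_of_nonneg_left hexp (div_nonneg hε hK0)
      _ = 2 * ε := by field_simp

/-! ## §2 The Duhamel / Gronwall comparison for `Γ̇ = −Γ·diag ḃ·Γ + X` -/

section Generic

variable {ι : Type*} [Fintype ι] [DecidableEq ι] [Nonempty ι]

set_option maxHeartbeats 800000 in
/-- **Duhamel comparison for the pair-vertex flow within one slice.**  Let `Γ, Γ̇ : ℝ → Matrix ι ι ℂ` and `b, ḃ : ℝ → ι → ℂ` with, for every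
`t ∈ [0,1]`: entrywise derivatives `HasDerivAt (Γ · x y) (Γ̇ t x y) t`, `HasDerivAt (b · a) (ḃ t a) t`; `|Γ(t)| ≤ m`; rung rate `Σ_a ‖ḃ t a‖ ≤ β`;
accumulated mass `Σ_a ‖b t a − b 0 a‖ ≤ Z`; `m·β ≤ 1/3`, `m·Z ≤ 1/3`; and the non-ladder forcing `X(t) = Γ̇(t) + Γ(t)·diag(ḃ t)·Γ(t)` bounded by
`ξ` entrywise.  Then for any right inverse `N` of `1 + diag(b 1 − b 0)·Γ 0`: `|Γ(1) − Γ(0)·N| ≤ 4·ξ` entrywise. -/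
theorem kllf_duhamel (Γ Γ' : ℝ → Matrix ι ι ℂ) (b b' : ℝ → ι → ℂ) {m β Z ξ : ℝ} (hm : 0 ≤ m) (hξ : 0 ≤ ξ)
    (hΓ : ∀ t ∈ Icc (0 : ℝ) 1, ∀ x y, HasDerivAt (fun s => Γ s x y) (Γ' t x y) t)
    (hb : ∀ t ∈ Icc (0 : ℝ) 1, ∀ a, HasDerivAt (fun s => b s a) (b' t a) t)
    (hΓm : ∀ t ∈ Icc (0 : ℝ) 1, ∀ x y, ‖Γ t x y‖ ≤ m) (hβ : ∀ t ∈ Icc (0 : ℝ) 1, ∑ a, ‖b' t a‖ ≤ β)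
    (hZ : ∀ t ∈ Icc (0 : ℝ) 1, ∑ a, ‖b t a - b 0 a‖ ≤ Z) (hmβ : m * β ≤ 1 / 3) (hmZ : m * Z ≤ 1 / 3)
    (hX : ∀ t ∈ Icc (0 : ℝ) 1, ∀ x y, ‖Γ' t x y + (Γ t * Matrix.diagonal (b' t) * Γ t) x y‖ ≤ ξ)
    (N : Matrix ι ι ℂ) (hN : (1 + Matrix.diagonal (b 1 - b 0) * Γ 0) * N = 1) (x y : ι) :
    ‖Γ 1 x y - (Γ 0 * N) x y‖ ≤ 4 * ξ := by
  -- the step weight and its smallness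
  set w : ℝ → ι → ℂ := fun t a => b t a - b 0 a with hw_def
  have hw1 : w 1 = b 1 - b 0 := rfl
  have hZ0 : 0 ≤ Z := le_trans (sum_nonneg fun a _ => norm_nonneg _) (hZ 0 (by norm_num))
  have hβ0 : 0 ≤ β := le_trans (sum_nonneg fun a _ => norm_nonneg _) (hβ 0 (by norm_num))
  -- the Bethe–Salpeter defect `R(t) = Γ(t)·(1 + diag(w t)·Γ 0) − Γ 0` and its derivative
  set R : ℝ → Matrix ι ι ℂ := fun t => Γ t * (1 + Matrix.diagonal (w t) * Γ 0) - Γ 0 with hR_def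
  set R' : ℝ → Matrix ι ι ℂ := fun t => Γ' t * (1 + Matrix.diagonal (w t) * Γ 0) + Γ t * Matrix.diagonal (b' t) * Γ 0 with hR'_def
  set X : ℝ → Matrix ι ι ℂ := fun t => Γ' t + Γ t * Matrix.diagonal (b' t) * Γ t with hX_def
  -- the LINEAR equation: `R' = X·(1 + diag w·Γ 0) − Γ·diag ḃ·R`
  have hlin : ∀ t, R' t = X t * (1 + Matrix.diagonal (w t) * Γ 0) - Γ t * Matrix.diagonal (b' t) * R t := by
    intro t
    simp only [hR'_def, hX_def, hR_def]
    noncomm_ring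
  -- entrywise derivative of `R`
  have hRderiv : ∀ t ∈ Icc (0 : ℝ) 1, ∀ x y, HasDerivAt (fun s => R s x y) (R' t x y) t := by
    intro t ht x y
    have hentry : ∀ s, R s x y = (∑ a, Γ s x a * ((1 : Matrix ι ι ℂ) a y + w s a * Γ 0 a y)) - Γ 0 x y := by
      intro s
      simp only [hR_def, Matrix.sub_apply]
      rw [Matrix.mul_apply]
      simp only [Matrix.add_apply, Matrix.diagonal_mul]
    have hentry' : R' t x y = ∑ a, (Γ' t x a * ((1 : Matrix ι ι ℂ) a y + w t a * Γ 0 a y) + Γ t x a * (b' t a * Γ 0 a y)) := by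
      simp only [hR'_def, Matrix.add_apply]
      rw [Matrix.mul_apply, klli_mul_diag_mul_apply, ← sum_add_distrib]
      refine sum_congr rfl fun a _ => ?_
      simp only [Matrix.add_apply, Matrix.diagonal_mul]
      ring
    have hws : ∀ a, HasDerivAt (fun s => w s a) (b' t a) t := by
      intro a
      have := (hb t ht a).sub_const (b 0 a)
      simpa [hw_def] using this
    have hterm : ∀ a, HasDerivAt (fun s => Γ s x a * ((1 : Matrix ι ι ℂ) a y + w s a * Γ 0 a y))
        (Γ' t x a * ((1 : Matrix ι ι ℂ) a y + w t a * Γ 0 a y) + Γ t x a * (b' t a * Γ 0 a y)) t := by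
      intro a
      have h1 : HasDerivAt (fun s => Γ s x a) (Γ' t x a) t := hΓ t ht x a
      have h2 : HasDerivAt (fun s => (1 : Matrix ι ι ℂ) a y + w s a * Γ 0 a y) (b' t a * Γ 0 a y) t := by
        have := ((hws a).mul_const (Γ 0 a y)).const_add ((1 : Matrix ι ι ℂ) a y)
        simpa using this
      exact h1.mul h2
    have hsum : HasDerivAt (fun s => ∑ a, Γ s x a * ((1 : Matrix ι ι ℂ) a y + w s a * Γ 0 a y))
        (∑ a, (Γ' t x a * ((1 : Matrix ι ι ℂ) a y + w t a * Γ 0 a y) + Γ t x a * (b' t a * Γ 0 a y))) t :=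
      HasDerivAt.fun_sum (u := (Finset.univ : Finset ι)) fun a _ => hterm a
    have hfull := hsum.sub_const (Γ 0 x y)
    rw [hentry']
    refine hfull.congr_of_eventuallyEq ?_
    exact Filter.Eventually.of_forall fun s => hentry s
  -- the Pi-valued curve `f t = (x,y) ↦ R t x y`
  set f : ℝ → (ι × ι → ℂ) := fun t p => R t p.1 p.2 with hf_def
  set f' : ℝ → (ι × ι → ℂ) := fun t p => R' t p.1 p.2 with hf'_def
  have hfderiv : ∀ t ∈ Icc (0 : ℝ) 1, HasDerivAt f (f' t) t := by
    intro t ht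
    rw [hasDerivAt_pi]
    intro p
    exact hRderiv t ht p.1 p.2
  have hfcont : ContinuousOn f (Icc (0 : ℝ) 1) :=
    fun t ht => (hfderiv t ht).continuousAt.continuousWithinAt
  have hf0 : ‖f 0‖ ≤ 0 := by
    have hd0 : Matrix.diagonal (w 0) = 0 := by
      ext i j
      by_cases h : i = j
      · subst h; simp [hw_def]
      · simp [Matrix.diagonal_apply_ne _ h]
    have : f 0 = 0 := by
      funext p
      show R 0 p.1 p.2 = 0
      have hR0 : R 0 = 0 := by
        show Γ 0 * (1 + Matrix.diagonal (w 0) * Γ 0) - Γ 0 = 0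
        rw [hd0, zero_mul, add_zero, mul_one, sub_self]
      rw [hR0, Matrix.zero_apply]
    rw [this, norm_zero]
  -- the differential inequality `‖f'‖ ≤ (m·β)·‖f‖ + (4/3)·ξ`
  have hbound : ∀ t ∈ Ico (0 : ℝ) 1, ‖f' t‖ ≤ (m * β) * ‖f t‖ + 4 / 3 * ξ := by
    intro t ht
    have ht' : t ∈ Icc (0 : ℝ) 1 := Ico_subset_Icc_self ht
    have hnn : 0 ≤ (m * β) * ‖f t‖ + 4 / 3 * ξ := by positivity
    rw [pi_norm_le_iff_of_nonneg hnn]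
    rintro ⟨x, y⟩
    show ‖R' t x y‖ ≤ (m * β) * ‖f t‖ + 4 / 3 * ξ
    rw [hlin t, Matrix.sub_apply]
    -- first piece: `X·(1 + diag w·Γ 0)` at `(x,y)`
    have hXe : ∀ a, ‖X t x a‖ ≤ ξ := fun a => by
      have := hX t ht' x a
      simpa [hX_def, Matrix.add_apply] using this
    have h1 : ‖(X t * (1 + Matrix.diagonal (w t) * Γ 0)) x y‖ ≤ 4 / 3 * ξ := by
      have hsplit : (X t * (1 + Matrix.diagonal (w t) * Γ 0)) x y = X t x y + ∑ a, X t x a * (w t a * Γ 0 a y) := by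
        rw [mul_add, mul_one, Matrix.add_apply, Matrix.mul_apply]
        congr 1
        refine sum_congr rfl fun a _ => ?_
        rw [Matrix.diagonal_mul]
      rw [hsplit]
      calc ‖X t x y + ∑ a, X t x a * (w t a * Γ 0 a y)‖ ≤ ‖X t x y‖ + ∑ a, ‖X t x a * (w t a * Γ 0 a y)‖ :=
            (norm_add_le _ _).trans (add_le_add le_rfl (norm_sum_le _ _))
        _ ≤ ξ + ∑ a, ξ * (‖w t a‖ * m) := by
            refine add_le_add (hXe y) (sum_le_sum fun a _ => ?_)
            rw [norm_mul, norm_mul]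
            exact mul_le_mul (hXe a) (mul_le_mul_of_nonneg_left (hΓm 0 (by norm_num) a y) (norm_nonneg _))
              (mul_nonneg (norm_nonneg _) (norm_nonneg _)) hξ
        _ = ξ + ξ * ((∑ a, ‖w t a‖) * m) := by rw [← mul_sum, sum_mul]
        _ ≤ ξ + ξ * (1 / 3) := by
            refine add_le_add le_rfl (mul_le_mul_of_nonneg_left ?_ hξ)
            calc (∑ a, ‖w t a‖) * m = m * ∑ a, ‖b t a - b 0 a‖ := by rw [mul_comm]
              _ ≤ m * Z := mul_le_mul_of_nonneg_left (hZ t ht') hm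
              _ ≤ 1 / 3 := hmZ
        _ = 4 / 3 * ξ := by ring
    -- second piece: `Γ·diag ḃ·R` at `(x,y)` against the sup norm of `f t`
    have h2 : ‖(Γ t * Matrix.diagonal (b' t) * R t) x y‖ ≤ (m * β) * ‖f t‖ := by
      rw [klli_mul_diag_mul_apply]
      calc ‖∑ c, Γ t x c * b' t c * R t c y‖ ≤ ∑ c, ‖Γ t x c * b' t c * R t c y‖ := norm_sum_le _ _
        _ ≤ ∑ c, m * ‖b' t c‖ * ‖f t‖ := by
            refine sum_le_sum fun c _ => ?_
            rw [norm_mul, norm_mul]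
            have hRc : ‖R t c y‖ ≤ ‖f t‖ := norm_le_pi_norm (f t) (c, y)
            exact mul_le_mul (mul_le_mul_of_nonneg_right (hΓm t ht' x c) (norm_nonneg _)) hRc (norm_nonneg _)
              (mul_nonneg hm (norm_nonneg _))
        _ = m * (∑ c, ‖b' t c‖) * ‖f t‖ := by rw [mul_sum, sum_mul]
        _ ≤ m * β * ‖f t‖ := by
            refine mul_le_mul_of_nonneg_right (mul_le_mul_of_nonneg_left (hβ t ht') hm) (norm_nonneg _)
    calc ‖(X t * (1 + Matrix.diagonal (w t) * Γ 0)) x y - (Γ t * Matrix.diagonal (b' t) * R t) x y‖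
        ≤ ‖(X t * (1 + Matrix.diagonal (w t) * Γ 0)) x y‖ + ‖(Γ t * Matrix.diagonal (b' t) * R t) x y‖ := norm_sub_le _ _
      _ ≤ 4 / 3 * ξ + (m * β) * ‖f t‖ := add_le_add h1 h2
      _ = (m * β) * ‖f t‖ + 4 / 3 * ξ := by ring
  -- Gronwall
  have hgron := norm_le_gronwallBound_of_norm_deriv_right_le (a := 0) (b := 1) hfcont
    (fun t ht => (hfderiv t (Ico_subset_Icc_self ht)).hasDerivWithinAt) hf0 hbound 1 (by norm_num)
  rw [sub_zero] at hgron
  have hK1 : m * β ≤ 1 := hmβ.trans (by norm_num)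
  have hR1 : ‖f 1‖ ≤ 8 / 3 * ξ := by
    refine hgron.trans ((kllf_gronwall_const (mul_nonneg hm hβ0) hK1 (by positivity)).trans ?_)
    linarith
  -- conclusion: `Γ 1 − Γ 0·N = R 1·N`, `|R 1·N| ≤ (3/2)·‖f 1‖`
  have hθ : m * ∑ a, ‖w 1 a‖ ≤ 1 / 3 := (mul_le_mul_of_nonneg_left (hZ 1 (by norm_num)) hm).trans hmZ
  obtain ⟨N', N₀, hN'1, hN'2, -, -, -, -, -, hCN, -, -⟩ := klcrs_single_slice (w 1) hm (Γ 0) (hΓm 0 (by norm_num)) hθ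
  have hNN' : N = N' := by
    calc N = (N' * (1 + Matrix.diagonal (w 1) * Γ 0)) * N := by rw [hN'2, one_mul]
      _ = N' * ((1 + Matrix.diagonal (w 1) * Γ 0) * N) := by rw [mul_assoc]
      _ = N' := by rw [hw1, hN, mul_one]
  have hid : Γ 1 - Γ 0 * N = R 1 * N := by
    have e1 : R 1 * N = Γ 1 * ((1 + Matrix.diagonal (w 1) * Γ 0) * N) - Γ 0 * N := by
      simp only [hR_def]; noncomm_ring
    rw [e1, hw1, hN, mul_one]
  have hNexp : N = 1 - Matrix.diagonal (w 1) * (Γ 0 * N) := klli_rightInv_expand (Γ 0) (Matrix.diagonal (w 1)) N (by rw [hw1]; exact hN)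
  have hid' : Γ 1 x y - (Γ 0 * N) x y = (R 1 * N) x y := by rw [← Matrix.sub_apply, hid]
  rw [hid']
  have hRN : (R 1 * N) x y = R 1 x y - ∑ a, R 1 x a * (w 1 a * (Γ 0 * N) a y) := by
    conv_lhs => rw [hNexp]
    rw [mul_sub, mul_one, Matrix.sub_apply, Matrix.mul_apply]
    congr 1
    refine sum_congr rfl fun a _ => ?_
    rw [Matrix.diagonal_mul]
  rw [hRN]
  have hRe : ∀ a, ‖R 1 x a‖ ≤ ‖f 1‖ := fun a => norm_le_pi_norm (f 1) (x, a)
  calc ‖R 1 x y - ∑ a, R 1 x a * (w 1 a * (Γ 0 * N) a y)‖ ≤ ‖R 1 x y‖ + ∑ a, ‖R 1 x a * (w 1 a * (Γ 0 * N) a y)‖ :=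
        (norm_sub_le _ _).trans (add_le_add le_rfl (norm_sum_le _ _))
    _ ≤ ‖f 1‖ + ∑ a, ‖f 1‖ * (‖w 1 a‖ * (3 / 2 * m)) := by
        refine add_le_add (hRe y) (sum_le_sum fun a _ => ?_)
        rw [norm_mul, norm_mul]
        refine mul_le_mul (hRe a) (mul_le_mul_of_nonneg_left ?_ (norm_nonneg _)) (mul_nonneg (norm_nonneg _) (norm_nonneg _))
          (norm_nonneg _)
        rw [hNN']; exact hCN a y
    _ = ‖f 1‖ * (1 + 3 / 2 * (m * ∑ a, ‖w 1 a‖)) := by rw [← mul_sum, ← sum_mul]; ring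
    _ ≤ ‖f 1‖ * (1 + 3 / 2 * (1 / 3)) := by gcongr
    _ ≤ 8 / 3 * ξ * (3 / 2) := by nlinarith [norm_nonneg (f 1)]
    _ = 4 * ξ := by ring

end Generic

/-! ## §3 (E2-v8) at `1 ≤ n` from the within-slice flow -/

section Model

variable (L M : ℕ) [NeZero L] [NeZero M]
variable {F : Type*} [Fintype F] [DecidableEq F] [Nonempty F]

/-- **(E2-v8) at `1 ≤ n` from the WITHIN-SLICE FLOW.**  Fix `F`, `a₀ : F`.  Per pair class `Qm` the engine supplies the flow data on
`t ∈ [0,1]` (slice `n`, from `Λ_{n−1}` to `Λ_n`): the pair vertex `Γ(t)` on `TorusSite 2 L × F` with its entrywise derivative `Γ̇(t)` and the bound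
`|Γ(t)| ≤ m`; the cumulative pair rungs `b(t)` with derivative `ḃ(t)`, rate `Σ‖ḃ(t)‖ ≤ β`, accumulated mass `Σ‖b(t) − b(0)‖ ≤ Z`, `m·β ≤ 1/3`,
`m·Z ≤ 1/3`; the step weight `z′ := b(1) − b(0)` with (m) `Σ‖z′‖ ≤ G.bhi`, (neg), (real); the non-ladder forcing bounded: `|Γ̇(t) + Γ(t)·diag ḃ(t)·Γ(t)|
≤ ξ` entrywise; the identification `𝒞_n(Qm;k,k′) = Γ(1)((k,a₀),(k′,a₀))` on the ball; the localisation `‖Γ(0)(a,b) − 𝒞̂_{n−1}(Qm;a.1,b.1)‖ ≤ ε`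
on relevant-or-external pairs; and `4·ξ + (9/4)·ε ≤ drivePBar + eremBar + thermalBar + legDressBarQ·countT` at every external pair.  Then
`PairLadderStepAtV8 … n`.  (Proof: `K := Γ(0)`, `T_K := Γ(0)·N`; `|𝒞_n − T_K| ≤ 4ξ` by `kllf_duhamel`; four-term `≤ (9/4)ε` by
`klli_fourTerm_le_of_sup`; `pairLadderStepAtV8_of_expansion`.) -/
theorem pairLadderStepAtV8_of_flow {G : GeoConsts} {P : SplitConsts} {Q : EngConsts} {β U μ : ℝ} {K₀ : TrigPolyC4v} {n : ℕ}
    (a₀ : F) (hn : 1 ≤ n)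
    (hsplit : PairArrayAtV2 L M P Q β U μ K₀ (n - 1)) (hD : 0 ≤ P.C_W + klLegKappa * Q.CR * P.Klam ^ 3)
    (hsmall : G.bhi * (2 * |U| + (P.C_W + klLegKappa * Q.CR * P.Klam ^ 3) * U ^ 2) ≤ 1 / 3)
    (hflow : ∀ Qm : TorusSite 2 L, IsPairClassAt L Qm n →
      ∃ (Γ Γ' : ℝ → Matrix (TorusSite 2 L × F) (TorusSite 2 L × F) ℂ) (b b' : ℝ → TorusSite 2 L × F → ℂ) (m βr Z ξ ε : ℝ),
        0 ≤ m ∧ 0 ≤ ξ ∧ 0 ≤ ε ∧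
        (∀ t ∈ Icc (0 : ℝ) 1, ∀ x y, HasDerivAt (fun s => Γ s x y) (Γ' t x y) t) ∧
        (∀ t ∈ Icc (0 : ℝ) 1, ∀ a, HasDerivAt (fun s => b s a) (b' t a) t) ∧
        (∀ t ∈ Icc (0 : ℝ) 1, ∀ x y, ‖Γ t x y‖ ≤ m) ∧ (∀ t ∈ Icc (0 : ℝ) 1, ∑ a, ‖b' t a‖ ≤ βr) ∧
        (∀ t ∈ Icc (0 : ℝ) 1, ∑ a, ‖b t a - b 0 a‖ ≤ Z) ∧ m * βr ≤ 1 / 3 ∧ m * Z ≤ 1 / 3 ∧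
        ∑ x, ‖(b 1 - b 0) x‖ ≤ G.bhi ∧
        (∑ p, ‖∑ c, (b 1 - b 0) (p, c)‖) - (∑ p, ∑ c, (b 1 - b 0) (p, c)).re ≤ 2 * klEdge G n (klTorusNorm L Qm) ∧
        (∀ p, (∑ c, (b 1 - b 0) (p, c)).im = 0) ∧
        (∀ t ∈ Icc (0 : ℝ) 1, ∀ x y, ‖Γ' t x y + (Γ t * Matrix.diagonal (b' t) * Γ t) x y‖ ≤ ξ) ∧
        (∀ k ∈ klBall L μ K₀, ∀ k' ∈ klBall L μ K₀, klPairAmplitude L M β U μ K₀ n Qm k k' = Γ 1 (k, a₀) (k', a₀)) ∧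
        (∀ a c : TorusSite 2 L × F, ((b 1 - b 0) a ≠ 0 ∨ (a.1 ∈ klBall L μ K₀ ∧ a.2 = a₀)) →
          ((b 1 - b 0) c ≠ 0 ∨ (c.1 ∈ klBall L μ K₀ ∧ c.2 = a₀)) → ‖Γ 0 a c - klPairArray L M β U μ K₀ (n - 1) Qm a.1 c.1‖ ≤ ε) ∧
        ∀ k ∈ klBall L μ K₀, ∀ k' ∈ klBall L μ K₀,
          4 * ξ + 9 / 4 * ε ≤ drivePBar G P U (n - 1) + eremBar G P Q U β L (n - 1) + thermalBar G P U β n +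
            legDressBarQ G P Q U n (legSliceCountT L β μ K₀ n ![k', Qm - k', Qm - k, k])) :
    PairLadderStepAtV8 L M G P Q β U μ K₀ n := by
  have hmC : 0 ≤ 2 * |U| + (P.C_W + klLegKappa * Q.CR * P.Klam ^ 3) * U ^ 2 := by
    have : 0 ≤ (P.C_W + klLegKappa * Q.CR * P.Klam ^ 3) * U ^ 2 := mul_nonneg hD (sq_nonneg U)
    have : 0 ≤ |U| := abs_nonneg U
    linarith
  refine pairLadderStepAtV8_of_expansion L M a₀ hn hsplit hD hsmall fun Qm hQm => ?_
  obtain ⟨Γ, Γ', b, b', m, βr, Z, ξ, ε, hm, hξ, hε, hΓ, hb, hΓm, hβ, hZ, hmβ, hmZ, hzsum, hmass, hreal, hX, hid, hloc, hbud⟩ :=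
    hflow Qm hQm
  set z' : TorusSite 2 L × F → ℂ := b 1 - b 0 with hz'_def
  have hzK : m * ∑ x, ‖z' x‖ ≤ 1 / 3 := by
    have : ∑ x, ‖z' x‖ ≤ Z := by
      have := hZ 1 (by norm_num)
      simpa [hz'_def] using this
    exact (mul_le_mul_of_nonneg_left this hm).trans hmZ
  obtain ⟨N, N₀, hN1, -, -, -, -, -, -, -, -, hser⟩ := klcrs_single_slice z' hm (Γ 0) (hΓm 0 (by norm_num)) hzK
  have hT := (klcrs_single_slice_ladder_hasSum z' hm (Γ 0) (hΓm 0 (by norm_num)) hzK N hN1).2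
  refine ⟨Γ 0, z', Γ 0 * N, m, hm, hΓm 0 (by norm_num), hzK, hzsum, hmass, hreal, hT, fun k hk k' hk' => ?_⟩
  have hzC : (2 * |U| + (P.C_W + klLegKappa * Q.CR * P.Klam ^ 3) * U ^ 2) * ∑ x, ‖z' x‖ ≤ 1 / 3 :=
    calc (2 * |U| + (P.C_W + klLegKappa * Q.CR * P.Klam ^ 3) * U ^ 2) * ∑ x, ‖z' x‖
        ≤ (2 * |U| + (P.C_W + klLegKappa * Q.CR * P.Klam ^ 3) * U ^ 2) * G.bhi := mul_le_mul_of_nonneg_left hzsum hmC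
      _ = G.bhi * (2 * |U| + (P.C_W + klLegKappa * Q.CR * P.Klam ^ 3) * U ^ 2) := mul_comm _ _
      _ ≤ 1 / 3 := hsmall
  -- the Duhamel bound at the external entry
  have hdu := kllf_duhamel Γ Γ' b b' hm hξ hΓ hb hΓm hβ hZ hmβ hmZ hX N (by simpa [hz'_def] using hN1) (k, a₀) (k', a₀)
  have h0 : ‖klPairAmplitude L M β U μ K₀ n Qm k k' - (Γ 0 * N) (k, a₀) (k', a₀)‖ ≤ 4 * ξ := by
    rw [hid k hk k' hk']; exact hdu
  have h4 := klli_fourTerm_le_of_sup (klPairArray L M β U μ K₀ (n - 1) Qm) (Γ 0) z' (fun a => a.1 ∈ klBall L μ K₀ ∧ a.2 = a₀)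
    hmC hm hε hzC hzK hloc (k, a₀) (k', a₀) ⟨hk, rfl⟩ ⟨hk', rfl⟩
  have hb' := hbud k hk k' hk'
  linarith

end Model

end Summit.HubbardSuperconductivity.HubbardSuperconductivity.Theorems.KLRegimeSplit

end
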